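import Literature.MathematicalPhysics.QuantumFieldTheory.Balaban1983to89.B9Eq343BlockLocalisedHolderPieces
import Literature.MathematicalPhysics.QuantumFieldTheory.Balaban1983to89.B9Eq384RemainderLetters

/-!
# `Balaban1983to89.B9Eq340HolderRowOfGradientRow` — T. Bałaban, *Propagators for lattice gauge theories in a background field*, Commun. Math. Phys. **99** (1985)
# 389–434 [Balaban1985BackgroundPropagators] (3.40) p. 397 (the η-scale Hölder quotients over `|x − x′| ≦ 1`), Thm 3.1 (3.42)–(3.43) pp. 397–398 (the
# covariant-gradient row and the Hölder members), (3.3) p. 391 (`∇^η_U`), (3.35) p. 396 (small gauge): **A LIPSCHITZ FIELD AT THE UNIT SCALE IS HÖLDER — on the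
# fine torus `T_{(Km)}` (`η = K⁻¹`) in the small-gauge MODEL `‖U(b) − 1‖ ≤ αη`, a site field with a WEIGHTED value row `N·e^{−δ d_m(Πp,v)}` and a WEIGHTED
# covariant-gradient row `‖(∇^η_Uf)(b)‖ ≤ G·e^{−δ d_m(Π(b₋),v)}` obeys the WEIGHTED η-scale Hölder row `‖f(x′) − f(x)‖ ≤ d·(G + 2M_φM_φ′αN)·e^{δ}·e^{−δ d_m(Πx,v)}·
# (dist(x,x′)∕K)^ε` on the pairs `dist ≤ K`, every `ε ≤ 1`** — the currency converter that turns the cell's landed GRADIENT rows (storey J: `exists_gradRow_GpOfUk`,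
# `exists_local_rows_G1kPi`, …) into inputs ∕ factors of STOREY H's Hölder letters (this lineage's HJ-2 `B9Eq3152ThirdWordPiGradRowOfHolderLetters`: (HLa)'s
# `R_k`-step, the value→Hölder legs); with the lattice-path lemma it rests on; NE9 crux-team LEAF PROVER 01, gen 92

statement-level skeleton of published theorems with citation tags; proofs where landed; nothing here is a claim about the Yang–Mills mass gap

CITATION HEADER (lean-in-tree rule).  Audit cell `pub-balaban`, sub-cell `t4`, BINDER row NE9; filed by NE9 crux-team LEAF PROVER 01 (`b2b-balaban-t4-ne9-formalise-leaf-01`,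
gen 92; bears_on: R4/N22).  Source READ first-hand this generation (`paper:balaban1985-cmp99-background-propagators`, journal page = PDF page + 388): p. 391 (3.3), p. 396 (3.35),
pp. 397–398 (3.39)–(3.43).  BY NAME: `B9SectCLatticeCarrier.shift` (the unit step), `B9Eq33CovDerivVector.covDeriv ∕ covDeriv_apply` ((3.3): `(∇_Uf)(b) = η⁻¹(R(U(b))f(b₊) −
f(b₋))`), `B9Eq384RemainderLetters.norm_adTransportW_sub_le` (`‖R(U(b))w − w‖ ≤ 2M_φM_φ′ε‖w‖`), `B4Sect5Torus.tdist ∕ ccoord ∕ circAbs_le_tdist`,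
`B4TorusKernel.MultiPeriod.abs_add_mul_centre ∕ circAbs_add_mul ∕ circAbs_le_abs`, (HJ-1) `tdist_blockCoord_le_one_of_tdist_le ∕ tdist_siteCast`; Mathlib's scoped
`Fin.NatCast ∕ Fin.CommRing`, `Real.rpow`.  Same declared currency as HJ-1∕HJ-2: PLAIN pair differences over the sup-distance ball `dist ≤ K`.

WHAT IS PROVED (sorry-free; proof lane — 0 `def`; [folklore]).
* §1 `iterate_shift_apply_ne ∕ _self` (the walk `x ↦ x + N·e_μ`), `norm_sub_le_of_steps` (telescoping).
* §2 **`update_eq_iterate_shift_or`** — two values of one coordinate are joined by the walk of `|t|` unit steps along the SHORTER arc (`t` the centred representative), with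
  its orientation.
* §3 **`norm_sub_le_of_step_bound`** — THE LATTICE PATH BOUND `‖f(x′) − f(x)‖ ≤ d·dist(x,x′)·B` from a step bound `B` on the ball `dist(·, x) ≤ dist(x, x′)` (coordinatewise
  interpolation `mix S`, Finset induction; every point of the path stays in the sup-ball).
* §4 **`holderRow_of_gradientRow`** — the statement of the title, on ANY fine torus `P = (Km)` through `siteCast` (row files apply it at `towerP L m (n+1)`).
HONEST SCOPE.  Lattice bookkeeping + one use of the model's transporter letter; NO propagator, NO estimate of [B9]; the weights of the value and gradient rows are
HYPOTHESES; nothing of Thm 3.1 is asserted; «NE9 ⇐ the named binders»; NE9 NOT PRINTED ∕ NOT PROVED; row WALLED ON A MODEL (O-NE9-1; #5 UNRULED); spine PROVED 0∕9; rung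
(B)+1 on a finite T⁴ — NOT infinite volume, NOT mass gap, NOT BetaPertH, NOT Clay.  HONEST DEPENDENCY: continuum YM on T⁴ ⇐ BetaPertH ∧ nine spine estimates (0/9 proved);
BetaPertH ⇐ (D1) ∧ (D4) ∧ CAP+tail; G-an2-4 gates asym, D1 and NE2/3/4.  NEW file importing (HJ-1) and `B9Eq384RemainderLetters`; nothing modified.  Net new unproved
facts: 0.
-/

noncomputable section

set_option autoImplicit false

open scoped BigOperators

namespace Literature.MathematicalPhysics.QuantumFieldTheory.Balaban1983to89.B9Eq340HolderRowOfGradientRow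

open Fin.NatCast Fin.CommRing
open B4Sect5Torus (TSite tdist ccoord tdist_nonneg tdist_triangle tdist_symm ccoord_cast)
open B4TorusKernel.MultiPeriod (circAbs centre abs_add_mul_centre circAbs_nonneg circAbs_le_abs circAbs_add_mul)
open B9SectCLatticeCarrier (Bond bpos btgt shift shift_apply_ne)

/-! ## §1 Walks along one lattice direction -/

section Walk

variable {d : ℕ} {P : Fin d → ℕ} {V : Type*} [NormedAddCommGroup V]

/-- Off the walking direction the iterated unit shift `x ↦ x + N·e_μ` does nothing. [folklore] [cite: Balaban1985BackgroundPropagators, (3.3) p.391] -/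
theorem iterate_shift_apply_ne (μ : Fin d) (N : ℕ) (x : TSite d P) {i : Fin d} (h : i ≠ μ) : ((shift μ)^[N] x) i = x i := by
  induction N with
  | zero => rfl
  | succ N ih => rw [Function.iterate_succ_apply', shift_apply_ne h, ih]

/-- In the walking direction the iterated unit shift adds `N` (mod `P_μ`). [folklore] [cite: Balaban1985BackgroundPropagators, (3.3) p.391] -/
theorem iterate_shift_apply_self (μ : Fin d) [NeZero (P μ)] (N : ℕ) (x : TSite d P) : ((shift μ)^[N] x) μ = x μ + (N : Fin (P μ)) := by
  induction N with
  | zero => simp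
  | succ N ih =>
    rw [Function.iterate_succ_apply']
    ext
    rw [B9SectCLatticeCarrier.shift_apply_val, ih, Nat.cast_succ, ← add_assoc, Fin.val_add (x μ + (N : Fin (P μ))) 1, Fin.val_one']
    simp [Nat.add_mod]

/-- Telescoping along a walk of `N` lattice steps, each changing `f` by at most `B`: `‖f(x + N·e_μ) − f(x)‖ ≤ N·B`. [folklore]
[cite: Balaban1985BackgroundPropagators, (3.40) p.397] -/
theorem norm_sub_le_of_steps (μ : Fin d) (f : TSite d P → V) (x : TSite d P) {B : ℝ} (N : ℕ)
    (h : ∀ j < N, ‖f ((shift μ)^[j + 1] x) - f ((shift μ)^[j] x)‖ ≤ B) : ‖f ((shift μ)^[N] x) - f x‖ ≤ N * B := by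
  induction N with
  | zero => simp
  | succ N ih =>
    have h1 := ih fun j hj => h j (Nat.lt_succ_of_lt hj)
    have h2 := h N (Nat.lt_succ_self N)
    calc ‖f ((shift μ)^[N + 1] x) - f x‖ = ‖(f ((shift μ)^[N + 1] x) - f ((shift μ)^[N] x)) + (f ((shift μ)^[N] x) - f x)‖ := by rw [sub_add_sub_cancel]
      _ ≤ ‖f ((shift μ)^[N + 1] x) - f ((shift μ)^[N] x)‖ + ‖f ((shift μ)^[N] x) - f x‖ := norm_add_le _ _
      _ ≤ B + N * B := add_le_add h2 h1
      _ = (N + 1 : ℕ) * B := by push_cast; ring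

end Walk

/-! ## §2 One coordinate: the shorter arc -/

section Arc

variable {d : ℕ} {P : Fin d → ℕ}

/-- **The shorter arc between two values of one coordinate**: with `t` the centred representative of `k′ − k` (`|t| = dist(k′ − k, P_iℤ)`,
`B4TorusKernel.MultiPeriod.abs_add_mul_centre`), either `t = |t|` and `update a i k′ = (·+e_i)^{|t|}(update a i k)`, or `t = −|t|` and
`update a i k = (·+e_i)^{|t|}(update a i k′)`. [folklore] [cite: Balaban1985BackgroundPropagators, (3.40) p.397] -/
theorem update_eq_iterate_shift_or (a : TSite d P) (i : Fin d) [NeZero (P i)] (k k' : Fin (P i)) :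
    let t : ℤ := (((k' : ℕ) : ℤ) - ((k : ℕ) : ℤ)) + (P i : ℕ) * centre (P i) (((k' : ℕ) : ℤ) - ((k : ℕ) : ℤ))
    (t = (t.natAbs : ℤ) ∧ Function.update a i k' = (shift i)^[t.natAbs] (Function.update a i k)) ∨
      (t = -(t.natAbs : ℤ) ∧ Function.update a i k = (shift i)^[t.natAbs] (Function.update a i k')) := by
  intro t
  have hcast : ((t : ℤ) : Fin (P i)) = k' - k := by
    show (((((k' : ℕ) : ℤ) - ((k : ℕ) : ℤ)) + (P i : ℕ) * centre (P i) (((k' : ℕ) : ℤ) - ((k : ℕ) : ℤ)) : ℤ) : Fin (P i)) = k' - k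
    have h0 : ((P i : ℕ) : Fin (P i)) = 0 := Fin.natCast_self (P i)
    push_cast
    rw [h0, zero_mul, add_zero]
  -- agreement off `i` and the two cases on `i`
  have key : ∀ (c c' : Fin (P i)) (N : ℕ), c' = c + (N : Fin (P i)) → Function.update a i c' = (shift i)^[N] (Function.update a i c) := by
    intro c c' N hc
    funext l
    by_cases hl : l = i
    · subst hl; rw [iterate_shift_apply_self, Function.update_self, Function.update_self, hc]
    · rw [iterate_shift_apply_ne _ _ _ hl, Function.update_of_ne hl, Function.update_of_ne hl]
  rcases Int.natAbs_eq t with h | h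
  · left
    refine ⟨h, key k k' t.natAbs ?_⟩
    have : ((t : ℤ) : Fin (P i)) = ((t.natAbs : ℕ) : Fin (P i)) := by conv_lhs => rw [h]; exact Int.cast_natCast _
    rw [← this, hcast]; abel
  · right
    refine ⟨h, key k' k t.natAbs ?_⟩
    have h2 : ((t : ℤ) : Fin (P i)) = -((t.natAbs : ℕ) : Fin (P i)) := by
      conv_lhs => rw [h]
      rw [Int.cast_neg, Int.cast_natCast]
    have h3 : -(((t.natAbs : ℕ) : Fin (P i))) = k' - k := by rw [← h2, hcast]
    have := congrArg (fun w => k' - w) h3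
    simp only [sub_neg_eq_add, sub_sub_cancel] at this
    exact this.symm

end Arc

/-! ## §3 The lattice path bound: `‖f(x′) − f(x)‖ ≤ d·dist(x,x′)·B` from a step bound on the ball -/

section Path

variable {d : ℕ} {P : Fin d → ℕ} [∀ i, NeZero (P i)] {V : Type*} [NormedAddCommGroup V]

/-- the value of `c + j` (mod `P_i`) differs from `c` by `j` up to a multiple of `P_i`. [folklore] -/
private theorem exists_val_add_natCast_sub (i : Fin d) (c : Fin (P i)) (j : ℕ) :
    ∃ q : ℤ, (((c + (j : Fin (P i)) : Fin (P i)) : ℕ) : ℤ) - ((c : ℕ) : ℤ) = j + (P i : ℕ) * q := by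
  have hv : (((c + (j : Fin (P i)) : Fin (P i)) : ℕ) : ℤ) = (((c : ℕ) + j : ℕ) : ℤ) % (P i : ℕ) := by
    rw [Fin.val_add, Fin.val_natCast, Nat.add_mod_mod]; push_cast; rfl
  refine ⟨-((((c : ℕ) + j : ℕ) : ℤ) / (P i : ℕ)), ?_⟩
  rw [hv, Int.emod_def]; push_cast; ring

omit [∀ i, NeZero (P i)] in
/-- a point whose coordinate distances to `x` are each dominated by some coordinate distance of `(x, x′)` is in the ball. [folklore] -/
private theorem sup_ccoord_le_of_forall (p x x' : TSite d P) (h : ∀ l, ∃ l', ccoord P p x l ≤ ccoord P x x' l') :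
    tdist P p x ≤ tdist P x x' := by
  unfold tdist
  have : Finset.univ.sup (ccoord P p x) ≤ Finset.univ.sup (ccoord P x x') := by
    refine Finset.sup_le fun l _ => ?_
    obtain ⟨l', hl'⟩ := h l
    exact hl'.trans (Finset.le_sup (Finset.mem_univ l'))
  exact_mod_cast this

omit [∀ i, NeZero (P i)] in
/-- `ccoord` through a `circAbs` bound, as naturals. [folklore] -/
private theorem ccoord_le_of_circAbs_le (hP : ∀ i, 1 ≤ P i) (p x : TSite d P) (l : Fin d) {n : ℕ}
    (h : circAbs (P l) (((p l : ℕ) : ℤ) - ((x l : ℕ) : ℤ)) ≤ n) : ccoord P p x l ≤ n := by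
  have := ccoord_cast hP p x l
  have h2 : ((ccoord P p x l : ℕ) : ℤ) ≤ n := by rw [this]; exact h
  exact_mod_cast h2

/-- **THE LATTICE PATH BOUND**: if every lattice step `p → p + e_μ` with both ends in the ball `dist(·, x) ≤ dist(x, x′)` changes `f` by at most `B`, then
`‖f(x′) − f(x)‖ ≤ d·dist(x, x′)·B` — move the coordinates of `x` to those of `x′` one at a time along the shorter arcs (every point of the path stays in
the ball of the sup-distance). [folklore] [cite: Balaban1985BackgroundPropagators, (3.40) p.397] -/
theorem norm_sub_le_of_step_bound (hP : ∀ i, 1 ≤ P i) (f : TSite d P → V) (x x' : TSite d P) {B : ℝ} (hB : 0 ≤ B)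
    (hstep : ∀ (p : TSite d P) (μ : Fin d), tdist P p x ≤ tdist P x x' → tdist P (shift μ p) x ≤ tdist P x x' → ‖f (shift μ p) - f p‖ ≤ B) :
    ‖f x' - f x‖ ≤ d * tdist P x x' * B := by
  classical
  -- the coordinatewise interpolation
  set mix : Finset (Fin d) → TSite d P := fun S l => if l ∈ S then x' l else x l with hmix
  have hmix0 : mix ∅ = x := by funext l; simp [hmix]
  have hmix1 : mix Finset.univ = x' := by funext l; simp [hmix]
  have ht0 : 0 ≤ tdist P x x' := tdist_nonneg _ _ _
  -- distance of the endpoints' coordinates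
  have hcc : ∀ l, (ccoord P x' x l : ℝ) ≤ tdist P x x' := fun l => by
    have h1 := B4Sect5Torus.circAbs_le_tdist hP x' x l
    rw [tdist_symm hP] at h1
    have h2 := ccoord_cast hP x' x l
    have h3 : ((ccoord P x' x l : ℕ) : ℝ) = ((circAbs (P l) (((x' l : ℕ) : ℤ) - ((x l : ℕ) : ℤ)) : ℤ) : ℝ) := by exact_mod_cast h2
    rw [h3]; exact h1
  -- the claim by induction on the set of moved coordinates
  suffices hS : ∀ S : Finset (Fin d), ‖f (mix S) - f x‖ ≤ S.card * tdist P x x' * B by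
    have := hS Finset.univ
    rw [hmix1, Finset.card_univ, Fintype.card_fin] at this
    exact this
  intro S
  induction S using Finset.induction_on with
  | empty => rw [hmix0, sub_self, norm_zero, Finset.card_empty]; simp
  | insert i S hi ih =>
    rw [Finset.card_insert_of_notMem hi]
    -- `mix (insert i S)` and `mix S` differ only at `i`: values `x′ i` and `x i`
    have hupd' : mix (insert i S) = Function.update (mix S) i (x' i) := by
      funext l; by_cases hl : l = i
      · subst hl; simp [hmix]
      · rw [Function.update_of_ne hl]; simp [hmix, hl]
    have hupd : mix S = Function.update (mix S) i (x i) := by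
      funext l; by_cases hl : l = i
      · subst hl; simp [hmix, hi]
      · rw [Function.update_of_ne hl]
    -- the centred offset and the number of steps
    set z : ℤ := ((x' i : ℕ) : ℤ) - ((x i : ℕ) : ℤ) with hz
    set t : ℤ := z + (P i : ℕ) * centre (P i) z with ht
    have habs : |t| = circAbs (P i) z := abs_add_mul_centre (hP i) z
    have hNcc : ((t.natAbs : ℕ) : ℤ) = ccoord P x' x i := by rw [Int.natCast_natAbs, habs, ccoord_cast hP]
    have hNle : (t.natAbs : ℝ) ≤ tdist P x x' := by
      have : ((t.natAbs : ℕ) : ℝ) = (ccoord P x' x i : ℝ) := by exact_mod_cast hNcc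
      rw [this]; exact hcc i
    -- coordinates off `i` of any point `update (mix S) i c`
    have hoff : ∀ (c : Fin (P i)) (l : Fin d), l ≠ i → ∃ l', ccoord P (Function.update (mix S) i c) x l ≤ ccoord P x x' l' := by
      intro c l hl
      refine ⟨l, ?_⟩
      unfold ccoord
      rw [Function.update_of_ne hl]
      by_cases hlS : l ∈ S
      · simp only [hmix, hlS, if_true]
        rw [show ((x' l : ℕ) : ℤ) - ((x l : ℕ) : ℤ) = -(((x l : ℕ) : ℤ) - ((x' l : ℕ) : ℤ)) by ring, B4Sect5Torus.circAbs_neg (hP l)]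
      · simp only [hmix, hlS, if_false, sub_self, B4Sect5Torus.circAbs_zero]
        exact Nat.zero_le _
    -- the walk, in either direction, stays in the ball and has `|t|` steps
    have hwalk : ∀ (c : Fin (P i)) (s : ℤ), (∃ w : ℤ, ((c : ℕ) : ℤ) - ((x i : ℕ) : ℤ) = s + (P i : ℕ) * w) →
        (∀ j : ℕ, j ≤ t.natAbs → |s + j| ≤ t.natAbs) →
        ‖f ((shift i)^[t.natAbs] (Function.update (mix S) i c)) - f (Function.update (mix S) i c)‖ ≤ t.natAbs * B := by
      intro c s hs hj
      obtain ⟨w, hw⟩ := hs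
      -- every point of the walk is in the ball
      have hball : ∀ j : ℕ, j ≤ t.natAbs → tdist P ((shift i)^[j] (Function.update (mix S) i c)) x ≤ tdist P x x' := by
        intro j hjle
        refine sup_ccoord_le_of_forall _ _ _ fun l => ?_
        by_cases hl : l = i
        · subst hl
          refine ⟨l, ?_⟩
          have hNcc' : ccoord P x x' l = t.natAbs := by
            have := B4Sect5Torus.ccoord_symm hP x x' l; rw [this]; exact_mod_cast hNcc.symm
          rw [hNcc']
          refine ccoord_le_of_circAbs_le hP _ _ l ?_
          rw [iterate_shift_apply_self, Function.update_self]
          obtain ⟨q, hq⟩ := exists_val_add_natCast_sub l c j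
          have e : (((c + (j : Fin (P l)) : Fin (P l)) : ℕ) : ℤ) - ((x l : ℕ) : ℤ) = (s + j) + (P l : ℕ) * (q + w) := by linarith
          rw [e, circAbs_add_mul]
          exact (circAbs_le_abs (hP l) _).trans (hj j hjle)
        · obtain ⟨l', hl'⟩ := hoff c l hl
          refine ⟨l', ?_⟩
          unfold ccoord at hl' ⊢
          rw [iterate_shift_apply_ne _ _ _ hl]
          exact hl'
      refine norm_sub_le_of_steps i f _ t.natAbs fun j hj' => ?_
      rw [Function.iterate_succ_apply']
      exact hstep _ i (hball j hj'.le) (by rw [← Function.iterate_succ_apply' (shift i)]; exact hball (j + 1) hj')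
    -- the two cases of the shorter arc
    have hstepS : ‖f (mix (insert i S)) - f (mix S)‖ ≤ t.natAbs * B := by
      rcases update_eq_iterate_shift_or (mix S) i (x i) (x' i) with ⟨_, h⟩ | ⟨hsign, h⟩
      · -- forward from `x i`: offsets `j`
        rw [hupd', h, ← hupd]
        have hw := hwalk (x i) 0 ⟨0, by simp⟩ (fun j hj => by
          rw [zero_add, Nat.abs_cast]; exact_mod_cast hj)
        rw [← hupd] at hw
        exact hw
      · -- forward from `x′ i` back to `x i`: offsets `t + j` with `t = −|t|`
        rw [hupd, h, ← hupd', norm_sub_rev]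
        have hz' : ∃ w : ℤ, ((x' i : ℕ) : ℤ) - ((x i : ℕ) : ℤ) = t + (P i : ℕ) * w := ⟨-centre (P i) z, by rw [ht, hz]; ring⟩
        have hsign' : t = -((t.natAbs : ℕ) : ℤ) := hsign
        have hw := hwalk (x' i) t hz' (fun j hj => by
          obtain ⟨N, hN⟩ : ∃ N : ℕ, t.natAbs = N := ⟨_, rfl⟩
          rw [hN] at hsign' hj ⊢
          rw [hsign', abs_le]; constructor <;> omega)
        rw [← hupd'] at hw
        exact hw
    calc ‖f (mix (insert i S)) - f x‖ = ‖(f (mix (insert i S)) - f (mix S)) + (f (mix S) - f x)‖ := by rw [sub_add_sub_cancel]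
      _ ≤ ‖f (mix (insert i S)) - f (mix S)‖ + ‖f (mix S) - f x‖ := norm_add_le _ _
      _ ≤ t.natAbs * B + S.card * tdist P x x' * B := add_le_add hstepS ih
      _ ≤ tdist P x x' * B + S.card * tdist P x x' * B := by nlinarith [mul_le_mul_of_nonneg_right hNle hB]
      _ = ((S.card : ℕ) + 1 : ℕ) * tdist P x x' * B := by push_cast; ring

end Path

/-! ## §4 The η-scale Hölder row from the covariant-gradient row (small gauge) -/

section Holder

open B9Eq319QprimeTorus (fineP blockCoord)
open B9Eq316TowerFlatIsOneStep (siteCast)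
open B9Eq33CovDerivVector (covDeriv covDeriv_apply)
open B9Eq310HessianOperator (adTransportW)
open B7Prop1Explicit (U1)
open B9Eq384RemainderLetters (norm_adTransportW_sub_le)
open B9Eq343BlockLocalisedHolderPieces (tdist_siteCast tdist_blockCoord_le_one_of_tdist_le)

variable {d : ℕ} (K : ℕ) [NeZero K] (m : Fin d → ℕ) [∀ i, NeZero (m i)]
  {𝔸 : Type*} [NormedRing 𝔸] [NormedAlgebra ℂ 𝔸] [NormOneClass 𝔸]
  {W : Type*} [NormedAddCommGroup W] [InnerProductSpace ℂ W] (φ : W ≃ₗ[ℂ] 𝔸) {Mφ Mφ' : ℝ}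
  (hφ : ∀ w, ‖φ w‖ ≤ Mφ * ‖w‖) (hφ' : ∀ X, ‖φ.symm X‖ ≤ Mφ' * ‖X‖) (hMφ : 0 ≤ Mφ) (hMφ' : 0 ≤ Mφ')

/-- `u ≤ u^ε` for `0 ≤ u ≤ 1`, `ε ≤ 1`. [folklore] -/
private theorem le_rpow_of_le_one' {u ε : ℝ} (hu0 : 0 ≤ u) (hu1 : u ≤ 1) (hε1 : ε ≤ 1) : u ≤ u ^ ε := by
  rcases eq_or_lt_of_le hu0 with h | h
  · rw [← h]; exact Real.rpow_nonneg le_rfl ε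
  · conv_lhs => rw [← Real.rpow_one u]
    exact Real.rpow_le_rpow_of_exponent_ge h hu1 hε1

include hφ hφ' hMφ hMφ' in
/-- **THE η-SCALE HÖLDER ROW FROM THE COVARIANT-GRADIENT ROW (small gauge).**  On a fine torus `T_P`, `P = (Km)`, spacing `η = K⁻¹`, background
`‖U(b) − 1‖ ≤ αη` in `U1`: a site field `f` with a weighted value row `‖f(p)‖ ≤ N·e^{−δ d_m(Πp, v)}` and a weighted covariant-gradient row
`‖(∇^η_Uf)(b)‖ ≤ G·e^{−δ d_m(Π(b₋), v)}` (print's (3.42) second member) obeys the weighted η-scale Hölder row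
`‖f(x′) − f(x)‖ ≤ d·(G + 2M_φM_φ′·α·N)·e^{δ}·e^{−δ d_m(Πx, v)}·(dist(x,x′)∕K)^ε` on the pairs `dist(x,x′) ≤ K`, for every `ε ≤ 1` — one lattice step costs
`η(‖∇_Uf‖ + 2M_φM_φ′α‖f‖)` (`R(U(b))f(b₊) − f(b₋) = η∇_Uf(b)`, `‖R(U(b))w − w‖ ≤ 2M_φM_φ′αη‖w‖`), the lattice path of §3 has `≤ d·dist` steps inside the blocks
adjacent to `Πx`, and `η·dist = dist∕K ≤ (dist∕K)^ε`. A Lipschitz field at the unit scale is Hölder: the (3.40)-currency reading of a gradient row. [folklore]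
[cite: Balaban1985BackgroundPropagators, (3.40) p.397, (3.42)–(3.43) pp.397–398, (3.3) p.391, (3.35) p.396] -/
theorem holderRow_of_gradientRow {P : Fin d → ℕ} (h : P = fineP K m) (hm : ∀ i, 1 ≤ m i) (U : Bond d P → 𝔸ˣ) {α η : ℝ} (hη : 0 < η)
    (hηK : η * K = 1) (hα : 0 ≤ α) (hUb : ∀ b, U b ∈ U1 𝔸) (hUη : ∀ b, ‖(U b : 𝔸) - 1‖ ≤ α * η)
    (f : TSite d P → W) (v : TSite d m) {N G δ ε : ℝ} (hN : 0 ≤ N) (hG : 0 ≤ G) (hδ : 0 ≤ δ) (hε1 : ε ≤ 1)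
    (hval : ∀ p, ‖f p‖ ≤ N * Real.exp (-(δ * tdist m (blockCoord K m (siteCast h p)) v)))
    (hgrad : ∀ b : Bond d P, ‖covDeriv ((η : ℂ))⁻¹ (adTransportW φ U) f b‖ ≤ G * Real.exp (-(δ * tdist m (blockCoord K m (siteCast h (bpos b))) v)))
    (x x' : TSite d P) (hxx : tdist P x x' ≤ K) :
    ‖f x' - f x‖ ≤ d * (G + 2 * Mφ * Mφ' * α * N) * Real.exp δ * Real.exp (-(δ * tdist m (blockCoord K m (siteCast h x)) v)) *
      (tdist P x x' / K) ^ ε := by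
  have hP : ∀ i, 1 ≤ P i := by intro i; rw [h]; exact Nat.one_le_iff_ne_zero.2 (Nat.mul_ne_zero (NeZero.ne K) (NeZero.ne (m i)))
  haveI : ∀ i, NeZero (P i) := fun i => ⟨Nat.one_le_iff_ne_zero.1 (hP i)⟩
  have hKpos : (0 : ℝ) < K := Nat.cast_pos.2 (Nat.pos_of_ne_zero (NeZero.ne K))
  set t : ℝ := tdist P x x' with ht
  set Ex : ℝ := Real.exp (-(δ * tdist m (blockCoord K m (siteCast h x)) v)) with hEx
  have ht0 : 0 ≤ t := tdist_nonneg _ _ _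
  have hEx0 : 0 ≤ Ex := Real.exp_nonneg _
  -- weights in the ball are comparable to the weight at `x`
  have hweight : ∀ p : TSite d P, tdist P p x ≤ t → Real.exp (-(δ * tdist m (blockCoord K m (siteCast h p)) v)) ≤ Real.exp δ * Ex := by
    intro p hp
    have hb : tdist m (blockCoord K m (siteCast h x)) (blockCoord K m (siteCast h p)) ≤ 1 :=
      tdist_blockCoord_le_one_of_tdist_le K m hm _ _ (by rw [tdist_siteCast, tdist_symm hP]; exact hp.trans hxx)
    rw [hEx, ← Real.exp_add]
    refine Real.exp_le_exp.2 ?_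
    have h1 := tdist_triangle hm (blockCoord K m (siteCast h x)) (blockCoord K m (siteCast h p)) v
    nlinarith [mul_le_mul_of_nonneg_left h1 hδ, mul_le_mul_of_nonneg_left hb hδ]
  -- the step bound on the ball
  set B : ℝ := η * (G + 2 * Mφ * Mφ' * α * N) * (Real.exp δ * Ex) with hB
  have hB0 : 0 ≤ B := by positivity
  have hstep : ∀ (p : TSite d P) (μ : Fin d), tdist P p x ≤ t → tdist P (shift μ p) x ≤ t → ‖f (shift μ p) - f p‖ ≤ B := by
    intro p μ hp hp'
    have hD := hgrad (p, μ)
    have hw : ‖adTransportW φ U (p, μ) (f (shift μ p)) - f (shift μ p)‖ ≤ 2 * Mφ * Mφ' * (α * η) * ‖f (shift μ p)‖ :=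
      norm_adTransportW_sub_le φ hφ hφ' hMφ' U (p, μ) (hUb _) (hUη _) (f (shift μ p))
    have e : f (shift μ p) - f p = -(adTransportW φ U (p, μ) (f (shift μ p)) - f (shift μ p)) +
        (η : ℂ) • covDeriv ((η : ℂ))⁻¹ (adTransportW φ U) f (p, μ) := by
      rw [covDeriv_apply, smul_smul, mul_inv_cancel₀ (by exact_mod_cast hη.ne'), one_smul]
      show f (shift μ p) - f p = -(adTransportW φ U (p, μ) (f (shift μ p)) - f (shift μ p)) + (adTransportW φ U (p, μ) (f (shift μ p)) - f p)
      abel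
    rw [e]
    refine (norm_add_le _ _).trans ?_
    rw [norm_neg, norm_smul, Complex.norm_real, Real.norm_eq_abs, abs_of_pos hη]
    have h1 := hval (shift μ p)
    have h2 := hweight (shift μ p) hp'
    have h3 := hweight p hp
    calc ‖adTransportW φ U (p, μ) (f (shift μ p)) - f (shift μ p)‖ + η * ‖covDeriv ((η : ℂ))⁻¹ (adTransportW φ U) f (p, μ)‖
        ≤ 2 * Mφ * Mφ' * (α * η) * (N * (Real.exp δ * Ex)) + η * (G * (Real.exp δ * Ex)) := by
          refine add_le_add (hw.trans ?_) (mul_le_mul_of_nonneg_left (hD.trans ?_) hη.le)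
          · exact mul_le_mul_of_nonneg_left (h1.trans (mul_le_mul_of_nonneg_left h2 hN)) (by positivity)
          · exact mul_le_mul_of_nonneg_left h3 hG
      _ = B := by rw [hB]; ring
  -- the path bound and the Hölder reading
  have hpath := norm_sub_le_of_step_bound hP f x x' hB0 hstep
  have hrpow : t / K ≤ (t / K) ^ ε := le_rpow_of_le_one' (div_nonneg ht0 hKpos.le) ((div_le_one hKpos).2 hxx) hε1
  have hηt : η = 1 / K := by field_simp; linarith [hηK]
  calc ‖f x' - f x‖ ≤ d * t * B := hpath
    _ = d * (G + 2 * Mφ * Mφ' * α * N) * Real.exp δ * Ex * (t / K) := by rw [hB, hηt]; ring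
    _ ≤ d * (G + 2 * Mφ * Mφ' * α * N) * Real.exp δ * Ex * (t / K) ^ ε := mul_le_mul_of_nonneg_left hrpow (by positivity)

end Holder

end Literature.MathematicalPhysics.QuantumFieldTheory.Balaban1983to89.B9Eq340HolderRowOfGradientRow

end
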